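import Mathlib
import HarnessLib
import Literature.Analysis.FluidPDE.TypeIAncientMild
import Literature.Analysis.FluidPDE.VorticityCalculus
import Literature.Analysis.FluidPDE.CurlFreeLiouville
import Literature.Analysis.FluidPDE.TsaiSelfSimilarBounded
import Summits.NavierStokesRegularity.NavierStokesRegularity.Theorems.PoloidalWindowDoorPoloidalWindowRigidityWindow
import Summits.NavierStokesRegularity.NavierStokesRegularity.Theorems.PoloidalWindowDoorPoloidalWindowRigidityLoopTangencyPin
import Summits.NavierStokesRegularity.NavierStokesRegularity.Theorems.PoloidalWindowDoorPoloidalWindowRigidityLayeredNoLoop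

/-!
# Route `PoloidalWindowDoor`, crux `PoloidalWindowRigidity` (K2, stmt-NavierStokesRegularity-19708) — LINE 15 `hot_split` (ns-idea-8 g7; census form of
# HL3′, critic idea-crit-7 g4 PASS-AS-SCAFFOLD, price P15-2), STUB A1 `stub_hotPlaneConst`: A HOT PLANE IS A CONSTANT PLANE

Cell ns-regularity-ideate, seat ns-poloidal-K2-p2 g12 (stub-worker on K2; `--supports` the crux item).  Statement VERBATIM
`Cruxes/PoloidalWindowRigidity/Lines/hot_split.lean` (crux-write 567c54c981f4) l.129–134, with the line-local package `Pinned C v` UNFOLDED to its nine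
conjuncts (a Theorems file cannot import the Cruxes workfile; by-name closure is `fun C v hP h y hy => stub_hotPlaneConst C v hP h y hy`).

CLAIM.  For a pinned class profile (Type-I rate, continuity, Oseen-mild, divergence-free, e₃-poloidal, `N = v₂(−1,0) ≠ 0`, global bound
`√(−t)|v₂| ≤ |N|`, `∇v₂(−1,0) = 0`, time/Laplace pins): if EVERY point of the plane `P₀ = {y₂ = 0}` is hot (`v₂(−1,y) = N`), then the slice `v(−1,·)` is
CONSTANT on `P₀` and `∂_z v₂(−1,·) = 0` there.  PROOF.  (1) Each `y ∈ P₀` maximises `|v₂(−1,·)|` over `ℝ³` (bound at `t = −1`), so `∇v₂(−1,y) = 0`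
(Fermat, `…LoopTangencyPin.fderiv_eq_zero_of_abs_le`); in particular `∂_z v₂ = ∂₀v₂ = ∂₁v₂ = 0` on `P₀`.  (2) On `P₀`, `ω₂ = ∂₀v₁ − ∂₁v₀ = 0` (poloidal) and
`div v = 0`; differentiating these identities ALONG the plane and using the symmetry of second derivatives,
`∂₀∂₀vᵢ + ∂₁∂₁vᵢ = ∂ᵢ(∂₀v₀ + ∂₁v₁) = −∂ᵢ∂₂v₂ = 0` on `P₀` for `i = 0, 1` (`sum_second_horiz_eq_zero_on_plane`), so `a ↦ vᵢ(a₀, a₁, 0)` is a bounded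
harmonic function on `ℝ²`, constant by Liouville (tree `isConst_of_harmonic_bounded`); with the hot hypothesis for the third component, `v(−1,y) = v(−1,0)`.

HONEST LABEL (P15-1): a reduction inside the census form of HL3′ («hot plane ⇒ constant plane»), NOT progress on 19708; cells C1/C2a/C2b and the wall stay OPEN.
WHAT THIS IS NOT: not a claim about Navier–Stokes regularity (bears_on LADDER-NS N0, rung N0-LocalTubeDoorPoloidal).
-/

noncomputable section

-- the summit and its single sub-problem share the name (CONVENTIONS §1), as in every Theorems file
set_option linter.dupNamespace false

namespace Summit.NavierStokesRegularity.NavierStokesRegularity.Theorems.PoloidalWindowDoorPoloidalWindowRigidityHotPlaneConst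

open MeasureTheory Set Function Filter Topology Metric InnerProductSpace
open scoped RealInnerProductSpace InnerProductSpace Laplacian
open Literature.Analysis Literature.Analysis.FluidPDE
open Summit.NavierStokesRegularity.NavierStokesRegularity.Theorems.PoloidalWindowDoorPoloidalWindowRigidityWindow
open Summit.NavierStokesRegularity.NavierStokesRegularity.Theorems.PoloidalWindowDoorPoloidalWindowRigidityLoopTangencyPin
open Summit.NavierStokesRegularity.NavierStokesRegularity.Theorems.PoloidalWindowDoorPoloidalWindowRigidityLayeredNoLoop

/-- **Tangential derivatives of a function vanishing on the plane `{y₂ = 0}` vanish on that plane.** [folklore] -/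
theorem fderiv_tangent_eq_zero_of_vanish_on_plane {f : EuclideanSpace ℝ (Fin 3) → ℝ} (hf : Differentiable ℝ f)
    (hzero : ∀ y : EuclideanSpace ℝ (Fin 3), y 2 = 0 → f y = 0) {y h : EuclideanSpace ℝ (Fin 3)} (hy : y 2 = 0) (hh : h 2 = 0) :
    fderiv ℝ f y h = 0 := by
  have hline : HasDerivAt (fun t : ℝ => y + t • h) h 0 := by
    simpa using ((hasDerivAt_id (0 : ℝ)).smul_const h).const_add y
  have hcomp : HasDerivAt (fun t : ℝ => f (y + t • h)) (fderiv ℝ f y h) 0 := by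
    have h1 : HasFDerivAt f (fderiv ℝ f y) (y + (0 : ℝ) • h) := by rw [zero_smul, add_zero]; exact (hf y).hasFDerivAt
    exact h1.comp_hasDerivAt (0 : ℝ) hline
  have hconst : (fun t : ℝ => f (y + t • h)) = fun _ => 0 := by
    funext t; exact hzero _ (by simp [hy, hh])
  rw [hconst] at hcomp
  exact hcomp.unique (hasDerivAt_const 0 (0 : ℝ)) ▸ rfl

/-- **Planar Laplacian of the horizontal components on a plane where `∇v₂ = 0`**: for `V ∈ C²(ℝ³; ℝ³)` divergence-free with `∂₀V₁ = ∂₁V₀` and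
`∂₂V₂ = 0` on the plane `{y₂ = 0}`, one has `∂₀∂₀Vᵢ + ∂₁∂₁Vᵢ = 0` on that plane for `i = 0, 1`. [folklore] -/
theorem sum_second_horiz_eq_zero_on_plane {V : EuclideanSpace ℝ (Fin 3) → EuclideanSpace ℝ (Fin 3)} (hV : ContDiff ℝ 2 V)
    (hsym : ∀ y : EuclideanSpace ℝ (Fin 3), y 2 = 0 → fderiv ℝ V y (EuclideanSpace.single 0 1) 1 = fderiv ℝ V y (EuclideanSpace.single 1 1) 0)
    (hdiv : VectorCalculus.IsDivFree V) (hw2 : ∀ y : EuclideanSpace ℝ (Fin 3), y 2 = 0 → fderiv ℝ V y (EuclideanSpace.single 2 1) 2 = 0)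
    (x : EuclideanSpace ℝ (Fin 3)) (hx : x 2 = 0) (i : Fin 3) (hi : i ≠ 2) :
    fderiv ℝ (fderiv ℝ V) x (EuclideanSpace.single 0 1) (EuclideanSpace.single 0 1) i +
      fderiv ℝ (fderiv ℝ V) x (EuclideanSpace.single 1 1) (EuclideanSpace.single 1 1) i = 0 := by
  set T : EuclideanSpace ℝ (Fin 3) →L[ℝ] EuclideanSpace ℝ (Fin 3) →L[ℝ] EuclideanSpace ℝ (Fin 3) := fderiv ℝ (fderiv ℝ V) x with hT
  set E0 : EuclideanSpace ℝ (Fin 3) := EuclideanSpace.single 0 1 with hE0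
  set E1 : EuclideanSpace ℝ (Fin 3) := EuclideanSpace.single 1 1 with hE1
  set E2 : EuclideanSpace ℝ (Fin 3) := EuclideanSpace.single 2 1 with hE2
  have hE0t : E0 2 = 0 := by simp [hE0]
  have hE1t : E1 2 = 0 := by simp [hE1]
  have hVd : Differentiable ℝ V := hV.differentiable two_ne_zero
  have hDd : Differentiable ℝ (fderiv ℝ V) := (hV.fderiv_right (m := 1) le_rfl).differentiable one_ne_zero
  have hentry : ∀ e : EuclideanSpace ℝ (Fin 3), ∀ j : Fin 3, Differentiable ℝ (fun y => fderiv ℝ V y e j) := fun e j =>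
    (contDiff_apply_coord_vec3 ((hV.fderiv_right (m := 1) le_rfl).clm_apply contDiff_const) j).differentiable one_ne_zero
  -- symmetry of the second derivative
  have hT2 : ∀ h k : EuclideanSpace ℝ (Fin 3), T h k = T k h := fun h k => (hV.contDiffAt.isSymmSndFDerivAt (by simp)) h k
  -- tangential derivatives of `∂₀V₁ - ∂₁V₀` vanish on the plane: `T k E0 1 = T k E1 0` for tangent `k`
  have hmix : ∀ k : EuclideanSpace ℝ (Fin 3), k 2 = 0 → T k E0 1 = T k E1 0 := by
    intro k hk
    have hg : Differentiable ℝ (fun y => fderiv ℝ V y E0 1 - fderiv ℝ V y E1 0) := (hentry E0 1).sub (hentry E1 0)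
    have h0 := fderiv_tangent_eq_zero_of_vanish_on_plane hg (fun y hy => by simp only [hsym y hy, sub_self]) hx hk
    rw [fderiv_fun_sub ((hentry E0 1) x) ((hentry E1 0) x)] at h0
    have h0' : fderiv ℝ (fun y => fderiv ℝ V y E0 1) x k - fderiv ℝ (fun y => fderiv ℝ V y E1 0) x k = 0 := h0
    clear h0
    have h0 := h0'
    rw [fderiv_fderiv_apply_coord hV, fderiv_fderiv_apply_coord hV] at h0
    rw [hT]; linarith
  -- tangential derivatives of `∂₂V₂` vanish on the plane
  have hz : ∀ k : EuclideanSpace ℝ (Fin 3), k 2 = 0 → T k E2 2 = 0 := by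
    intro k hk
    have h0 := fderiv_tangent_eq_zero_of_vanish_on_plane (hentry E2 2) hw2 hx hk
    rwa [fderiv_fderiv_apply_coord hV] at h0
  -- the derivative of the divergence vanishes: `Σⱼ T k Eⱼ j = 0`
  have hdiv' : ∀ k : EuclideanSpace ℝ (Fin 3), T k E0 0 + T k E1 1 + T k E2 2 = 0 := by
    intro k
    have hzero : (fun y => ∑ j, fderiv ℝ V y (EuclideanSpace.single j (1 : ℝ)) j) = fun _ => (0 : ℝ) := by
      funext y
      have := hdiv y
      rw [VectorCalculus.divergence, trace_eq_sum_coord] at this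
      exact this
    have h1 : fderiv ℝ (fun y => ∑ j, fderiv ℝ V y (EuclideanSpace.single j (1 : ℝ)) j) x k =
        ∑ j, T k (EuclideanSpace.single j (1 : ℝ)) j := by
      rw [fderiv_fun_sum fun j _ => (hentry _ j) x, _root_.sum_apply]
      exact Finset.sum_congr rfl fun j _ => fderiv_fderiv_apply_coord hV x _ _ j
    have h2 : ∑ j, T k (EuclideanSpace.single j (1 : ℝ)) j = 0 := by rw [← h1, hzero]; simp
    simpa [Fin.sum_univ_three, hE0, hE1, hE2] using h2
  fin_cases i
  · have h1 : T E1 E1 0 = T E0 E1 1 := by rw [← hmix E1 hE1t, hT2 E1 E0]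
    have h2 := hdiv' E0
    have h3 : T E0 E2 2 = 0 := hz E0 hE0t
    simp only [Fin.zero_eta, Fin.isValue]
    linarith
  · have h1 : T E0 E0 1 = T E1 E0 0 := by rw [hmix E0 hE0t, hT2 E0 E1]
    have h2 := hdiv' E1
    have h3 : T E1 E2 2 = 0 := hz E1 hE1t
    simp only [Fin.mk_one, Fin.isValue]
    linarith
  · exact absurd rfl hi

/-- **Liouville on the plane `{y₂ = 0}`**: under the hypotheses of `sum_second_horiz_eq_zero_on_plane` and a bound on `V`, the horizontal components are
constant on the plane. [folklore] -/
theorem planar_const_on_plane {V : EuclideanSpace ℝ (Fin 3) → EuclideanSpace ℝ (Fin 3)} (hV : ContDiff ℝ 2 V)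
    (hsym : ∀ y : EuclideanSpace ℝ (Fin 3), y 2 = 0 → fderiv ℝ V y (EuclideanSpace.single 0 1) 1 = fderiv ℝ V y (EuclideanSpace.single 1 1) 0)
    (hdiv : VectorCalculus.IsDivFree V) (hw2 : ∀ y : EuclideanSpace ℝ (Fin 3), y 2 = 0 → fderiv ℝ V y (EuclideanSpace.single 2 1) 2 = 0)
    {B : ℝ} (hB : ∀ y, ‖V y‖ ≤ B) (i : Fin 3) (hi : i ≠ 2) (y y' : EuclideanSpace ℝ (Fin 3)) (hy : y 2 = 0) (hy' : y' 2 = 0) :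
    V y i = V y' i := by
  let L : EuclideanSpace ℝ (Fin 2) →L[ℝ] EuclideanSpace ℝ (Fin 3) :=
    (EuclideanSpace.proj (𝕜 := ℝ) (0 : Fin 2)).smulRight (EuclideanSpace.single 0 1) +
      (EuclideanSpace.proj (𝕜 := ℝ) (1 : Fin 2)).smulRight (EuclideanSpace.single 1 1)
  have hL0 : L (EuclideanSpace.single 0 1) = EuclideanSpace.single 0 1 := by ext j; fin_cases j <;> simp [L]
  have hL1 : L (EuclideanSpace.single 1 1) = EuclideanSpace.single 1 1 := by ext j; fin_cases j <;> simp [L]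
  have hL2 : ∀ a, L a 2 = 0 := fun a => by simp [L]
  have hchart : ∀ x : EuclideanSpace ℝ (Fin 3), x 2 = 0 → L (EuclideanSpace.single 0 (x 0) + EuclideanSpace.single 1 (x 1)) = x := by
    intro x hx; ext j; fin_cases j <;> simp [L, hx]
  set g : EuclideanSpace ℝ (Fin 3) → ℝ := fun x => V x i with hg
  have hg2 : ContDiff ℝ 2 g := contDiff_apply_coord_vec3 hV i
  set η : EuclideanSpace ℝ (Fin 2) → ℝ := g ∘ L with hη
  have hη2 : ContDiff ℝ 2 η := hg2.comp L.contDiff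
  have hΔ : ∀ a, (Δ η) a = 0 := by
    intro a
    rw [laplacian_eq_iteratedFDeriv_orthonormalBasis η (EuclideanSpace.basisFun (Fin 2) ℝ)]
    simp only [Fin.sum_univ_two, EuclideanSpace.basisFun_apply]
    rw [hη, L.iteratedFDeriv_comp_right hg2 a le_rfl]
    simp only [ContinuousMultilinearMap.compContinuousLinearMap_apply]
    have e : ∀ u : EuclideanSpace ℝ (Fin 2), (fun k : Fin 2 => L (![u, u] k)) = ![L u, L u] := by
      intro u; funext k; fin_cases k <;> rfl
    rw [e (EuclideanSpace.single 0 1), e (EuclideanSpace.single 1 1), hL0, hL1, iteratedFDeriv_two_apply, iteratedFDeriv_two_apply]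
    simp only [Matrix.cons_val_zero, Matrix.cons_val_one, Matrix.cons_val_fin_one]
    rw [hg, fderiv_fderiv_coord hV, fderiv_fderiv_coord hV]
    exact sum_second_horiz_eq_zero_on_plane hV hsym hdiv hw2 (L a) (hL2 a) i hi
  have hharm : HarmonicOnNhd η univ := harmonicOnNhd_of_laplacian_eq_zero hη2 hΔ
  have hbdd : ∃ B', ∀ a, |η a| ≤ B' := ⟨B, fun a => by
    have h1 : |V (L a) i| ≤ ‖V (L a)‖ := by simpa [Real.norm_eq_abs] using PiLp.norm_apply_le (V (L a)) i
    exact h1.trans (hB _)⟩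
  have hconst := isConst_of_harmonic_bounded hharm hbdd
    (EuclideanSpace.single 0 (y 0) + EuclideanSpace.single 1 (y 1)) (EuclideanSpace.single 0 (y' 0) + EuclideanSpace.single 1 (y' 1))
  simp only [hη, hg, comp_apply] at hconst
  rwa [hchart y hy, hchart y' hy'] at hconst

/-- **STUB A1 `stub_hotPlaneConst` of LINE 15 `hot_split` (VERBATIM, `Pinned` unfolded): a hot plane is a constant plane.**  See the module docstring. -/
theorem stub_hotPlaneConst :
    ∀ (C : ℝ) (v : ℝ → EuclideanSpace ℝ (Fin 3) → EuclideanSpace ℝ (Fin 3)),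
      (Literature.Analysis.FluidPDE.HasTypeITimeDecay C v ∧
        ContinuousOn (Function.uncurry v) (Set.Iio (0 : ℝ) ×ˢ Set.univ) ∧
        (∀ s t : ℝ, s < t → t < 0 → ∀ x, v t x =
          Literature.Analysis.UnboundedOperators.heatExtension (v s) (t - s) x -
            Literature.Analysis.FluidPDE.oseenDuhamel 1 s v v t x) ∧
        (∀ t < 0, Literature.Analysis.FluidPDE.VectorCalculus.IsDivFree (v t)) ∧
        (∀ s < 0, ∀ y, ⟪Literature.Analysis.FluidPDE.curl (v s) y, EuclideanSpace.single 2 1⟫_ℝ = 0) ∧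
        v (-1) 0 2 ≠ 0 ∧ (∀ t < 0, ∀ x, Real.sqrt (-t) * |v t x 2| ≤ |v (-1) 0 2|) ∧
        (∀ h : EuclideanSpace ℝ (Fin 3), fderiv ℝ (v (-1)) 0 h 2 = 0) ∧
        (deriv (fun s => v s 0 2) (-1) = v (-1) 0 2 / 2 ∧ v (-1) 0 2 * (Δ (fun y => v (-1) y 2)) 0 ≤ 0)) →
      (∀ y : EuclideanSpace ℝ (Fin 3), y 2 = 0 → v (-1) y 2 = v (-1) 0 2) →
      ∀ y : EuclideanSpace ℝ (Fin 3), y 2 = 0 →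
        v (-1) y = v (-1) 0 ∧ fderiv ℝ (fun x => v (-1) x 2) y (EuclideanSpace.single 2 1) = 0 := by
  rintro C v ⟨hrate, hcont, hmild, hdiv, hpol, _hN, hsup, _hgrad, _hpins⟩ hhot y hy
  -- smoothness of the slice `V := v (-1)`
  have hA : IsTypeIAncientMild C v := isTypeIAncientMild_of_class hrate hcont hmild hdiv
  have hvs : ContDiff ℝ (⊤ : ℕ∞) (v (-1)) := hA.contDiff_slice (by norm_num)
  have hV2 : ContDiff ℝ 2 (v (-1)) := contDiff_infty.1 hvs 2
  have hVd : Differentiable ℝ (v (-1)) := hV2.differentiable two_ne_zero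
  -- (1) Fermat on the hot plane: `∇v₂(-1, x) = 0` for `x 2 = 0`
  have hgrad : ∀ x : EuclideanSpace ℝ (Fin 3), x 2 = 0 → ∀ h, fderiv ℝ (v (-1)) x h 2 = 0 := by
    intro x hx h
    have hle : ∀ z, |(fun z => v (-1) z 2) z| ≤ |(fun z => v (-1) z 2) x| := fun z => by
      have h1 := hsup (-1) (by norm_num) z
      simp only [neg_neg, Real.sqrt_one, one_mul] at h1
      simp only [hhot x hx]
      exact h1
    have h0 := fderiv_eq_zero_of_abs_le hle
    rw [← fderiv_apply_coord_vec3 (hVd x) 2 h, h0]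
    simp
  refine ⟨?_, by rw [fderiv_apply_coord_vec3 (hVd y) 2]; exact hgrad y hy _⟩
  -- (2) the horizontal components are planar harmonic on the plane, hence constant
  have hpol1 : ∀ x, curl (v (-1)) x 2 = 0 := fun x => by
    have h := hpol (-1) (by norm_num) x
    simpa [EuclideanSpace.inner_single_right] using h
  have hsym : ∀ x : EuclideanSpace ℝ (Fin 3), x 2 = 0 →
      fderiv ℝ (v (-1)) x (EuclideanSpace.single 0 1) 1 = fderiv ℝ (v (-1)) x (EuclideanSpace.single 1 1) 0 := by
    intro x _
    have h := hpol1 x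
    simpa [curl, sub_eq_zero] using h
  have hB : ∀ x, ‖v (-1) x‖ ≤ C / Real.sqrt (-(-1 : ℝ)) := fun x => hrate (-1) (by norm_num) x
  have hw2 : ∀ x : EuclideanSpace ℝ (Fin 3), x 2 = 0 → fderiv ℝ (v (-1)) x (EuclideanSpace.single 2 1) 2 = 0 :=
    fun x hx => hgrad x hx _
  have h02 : (0 : EuclideanSpace ℝ (Fin 3)) 2 = 0 := rfl
  ext i
  by_cases hi : i = 2
  · subst hi; rw [hhot y hy]
  · exact planar_const_on_plane hV2 hsym (hdiv (-1) (by norm_num)) hw2 hB i hi y 0 hy h02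

end Summit.NavierStokesRegularity.NavierStokesRegularity.Theorems.PoloidalWindowDoorPoloidalWindowRigidityHotPlaneConst
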